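import Mathlib.Data.ZMod.QuotientGroup
import Mathlib.GroupTheory.Coset.Card
import Mathlib.Algebra.BigOperators.Fin
import HarnessLib

/-!
# The rank of the simple semi-homogeneous bundle of slope `δ = [L]/ℓ` ([Muk78] Thm 7.11 (5)): the arithmetic

Mukai, *Semi-homogeneous vector bundles on an abelian variety*, J. Math. Kyoto Univ. 18 (1978) 239–272,
THEOREM 7.11 (p. 271), for a simple semi-homogeneous vector bundle `E` on an abelian variety `X` of dimension
`g` with `δ(E) = [L]/ℓ`: «(4) There are exact sequences of group schemes `0 → X_ℓ ∩ K(L) → X_ℓ → Σ(E) → 0` …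
(5) `ord(X_ℓ ∩ K(L)) = u²` for some positive integer `u`. For this `u`, we have `r(E) = ℓ^g/u` and
`χ(E) = χ(L)/u`.»; COR 7.12 / REM 7.13 (pp. 271–272): on a principally polarized `(X, Ξ)` with `δ = Ξ/2`
the simple bundle has `r = 2^g`.

The cell-side CLOSED FORM `r(E) = Π_{i=1}^{g} ℓ / gcd(ℓ, dᵢ)` for `L` of type `(d₁, …, d_g)` is a one-line
reading of (5) through `K(L) ≅ (⊕ᵢ ℤ/dᵢ)²` for `L` non-degenerate of (separable) type `δ = (d₁, …, d_g)`
([Mumford1966EquationsI] §1 «of type δ», `K(δ) = H(δ) × Ĥ(δ)`, `H(δ) = ⊕ᵢ ℤ/dᵢ`; [MumfordAV1970] §23; BY NAME — not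
typed here) and `X_ℓ ∩ K(L) = K(L)[ℓ]`. THIS FILE proves
the finite-group arithmetic of that reading — nothing else:

* (private helpers) `#{x ∈ ℤ/d : ℓ·x = 0} = gcd(d, ℓ)` (cyclic groups) and «the `ℓ`-torsion of a finite product is
  the product of the `ℓ`-torsions» — folklore plumbing for the two cited statements below;
* `card_nsmul_eq_zero_mumfordGroup_sq` — for `K = (Πᵢ ℤ/dᵢ) × (Πᵢ ℤ/dᵢ)`: `#K[ℓ] = (Πᵢ gcd(dᵢ, ℓ))²`,
  i.e. Mukai's `u = Πᵢ gcd(dᵢ, ℓ)`;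
* `pow_div_prod_gcd` — `ℓ^g / Πᵢ gcd(dᵢ, ℓ) = Πᵢ ℓ / gcd(dᵢ, ℓ)`, i.e. `r(E) = ℓ^g/u = Πᵢ ℓ/gcd(dᵢ, ℓ)`;
  instance `dᵢ = 1`, `ℓ = 2` ⇒ `2^g` (REM 7.13).

What is NOT here: abelian varieties, `K(L)`, `Σ(E)`, or Theorem 7.11 itself — those are inputs BY NAME; no
`def`, no named fact, nothing about any conjecture.
-/

namespace Literature.AlgebraicGeometry.AbelianVarieties

open Finset

/-- In the cyclic group `ℤ/d` (`d ≠ 0`) the number of solutions of `ℓ • x = 0` is `gcd(d, ℓ)`: the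
`ℓ`-torsion is the kernel of `x ↦ ℓx`, whose image `⟨ℓ⟩` has order `d / gcd(d, ℓ)`. [folklore] -/
private theorem card_nsmul_eq_zero_zmod (d ℓ : ℕ) [NeZero d] :
    Nat.card {x : ZMod d // ℓ • x = 0} = Nat.gcd d ℓ := by
  classical
  set f : ZMod d →+ ZMod d := AddMonoidHom.mulLeft (ℓ : ZMod d) with hf
  have hker : Nat.card {x : ZMod d // ℓ • x = 0} = Nat.card f.ker := by
    refine Nat.card_congr (Equiv.subtypeEquivRight fun x => ?_)
    rw [AddMonoidHom.mem_ker, hf, AddMonoidHom.coe_mulLeft, nsmul_eq_mul]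
  have hrange : f.range = AddSubgroup.zmultiples (ℓ : ZMod d) := by
    ext x
    constructor
    · rintro ⟨y, rfl⟩
      rw [hf, AddMonoidHom.coe_mulLeft, ← ZMod.natCast_zmod_val y, ← Nat.cast_mul, mul_comm, Nat.cast_mul,
        ← nsmul_eq_mul]
      exact AddSubgroup.nsmul_mem _ (AddSubgroup.mem_zmultiples _) _
    · rintro ⟨n, rfl⟩
      refine ⟨(n : ZMod d), ?_⟩
      show (ℓ : ZMod d) * (n : ZMod d) = n • (ℓ : ZMod d)
      rw [zsmul_eq_mul, mul_comm]
  have hcr : Nat.card f.range = d / Nat.gcd d ℓ := by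
    rw [hrange, Nat.card_zmultiples, ZMod.addOrderOf_coe _ (NeZero.ne d)]
  have hmul : Nat.card f.ker * Nat.card f.range = d := by
    rw [← Nat.card_congr (QuotientAddGroup.quotientKerEquivRange f).toEquiv, mul_comm,
      ← AddSubgroup.card_eq_card_quotient_mul_card_addSubgroup, Nat.card_zmod]
  have hg : 0 < d / Nat.gcd d ℓ :=
    Nat.div_pos (Nat.le_of_dvd (Nat.pos_of_ne_zero (NeZero.ne d)) (Nat.gcd_dvd_left d ℓ))
      (Nat.gcd_pos_of_pos_left ℓ (Nat.pos_of_ne_zero (NeZero.ne d)))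
  rw [hker]
  rw [hcr] at hmul
  calc Nat.card f.ker = d / (d / Nat.gcd d ℓ) := (Nat.div_eq_of_eq_mul_left hg hmul.symm).symm
    _ = Nat.gcd d ℓ := Nat.div_div_self (Nat.gcd_dvd_left d ℓ) (NeZero.ne d)

/-- The `ℓ`-torsion of a finite product is the product of the `ℓ`-torsions. [folklore] -/
private theorem card_nsmul_eq_zero_pi {ι : Type*} [Fintype ι] (G : ι → Type*) [∀ i, AddCommMonoid (G i)] (ℓ : ℕ) :
    Nat.card {x : (∀ i, G i) // ℓ • x = 0} = ∏ i, Nat.card {y : G i // ℓ • y = 0} := by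
  rw [← Nat.card_pi]
  refine Nat.card_congr ((Equiv.subtypeEquivRight fun x => ?_).trans (Equiv.subtypePiEquivPi))
  exact funext_iff

/-- Mukai's `u` for `L` of type `(d₁, …, d_g)`: with `K(L) ≅ (⊕ᵢ ℤ/dᵢ)²` ([Mumford1966EquationsI] §1 ∕
[MumfordAV1970] §23, by name) and
`X_ℓ ∩ K(L) = K(L)[ℓ]`, THM 7.11 (5)'s «`ord(X_ℓ ∩ K(L)) = u²`» has `u = Πᵢ gcd(dᵢ, ℓ)`:
`#{x ∈ (Πᵢ ℤ/dᵢ) × (Πᵢ ℤ/dᵢ) : ℓx = 0} = (Πᵢ gcd(dᵢ, ℓ))²`. [cite: Mukai1978, Thm 7.11 (5) (p. 271)] -/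
theorem card_nsmul_eq_zero_mumfordGroup_sq {g : ℕ} (d : Fin g → ℕ) [∀ i, NeZero (d i)] (ℓ : ℕ) :
    Nat.card {x : (∀ i, ZMod (d i)) × (∀ i, ZMod (d i)) // ℓ • x = 0} = (∏ i, Nat.gcd (d i) ℓ) ^ 2 := by
  have hpi : Nat.card {x : (∀ i, ZMod (d i)) // ℓ • x = 0} = ∏ i, Nat.gcd (d i) ℓ := by
    rw [card_nsmul_eq_zero_pi]
    exact Finset.prod_congr rfl fun i _ => card_nsmul_eq_zero_zmod (d i) ℓ
  rw [sq, ← hpi, ← Nat.card_prod]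
  refine Nat.card_congr ((Equiv.subtypeEquivRight fun x => ?_).trans (Equiv.subtypeProdEquivProd))
  exact Prod.ext_iff

/-- `r(E) = ℓ^g / u = Πᵢ ℓ / gcd(dᵢ, ℓ)` — the closed form of [Muk78] THM 7.11 (5)'s rank for slope `[L]/ℓ`,
`L` of type `(d₁, …, d_g)` (with `u = Πᵢ gcd(dᵢ, ℓ)` from `card_nsmul_eq_zero_mumfordGroup_sq`). Pure arithmetic:
each `gcd(dᵢ, ℓ)` divides `ℓ`. REM 7.13's instance: `dᵢ = 1`, `ℓ = 2` gives `2^g`.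
[cite: Mukai1978, Thm 7.11 (5), Cor 7.12, Rem 7.13 (pp. 271–272)] -/
theorem pow_div_prod_gcd {g : ℕ} (d : Fin g → ℕ) (ℓ : ℕ) :
    ℓ ^ g / ∏ i, Nat.gcd (d i) ℓ = ∏ i, ℓ / Nat.gcd (d i) ℓ := by
  rcases Nat.eq_zero_or_pos (∏ i, Nat.gcd (d i) ℓ) with h0 | hpos
  · -- some gcd(dᵢ, ℓ) = 0, i.e. dᵢ = ℓ = 0: both sides are 0 (`g ≥ 1` is forced)
    obtain ⟨i, -, hi⟩ := Finset.prod_eq_zero_iff.mp h0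
    have hℓ : ℓ = 0 := (Nat.gcd_eq_zero_iff.mp hi).2
    rw [h0, Nat.div_zero]
    exact (Finset.prod_eq_zero (Finset.mem_univ i) (by rw [hi, Nat.div_zero])).symm
  refine Nat.div_eq_of_eq_mul_left hpos ?_
  rw [← Finset.prod_mul_distrib, Finset.prod_congr rfl fun i _ => Nat.div_mul_cancel (Nat.gcd_dvd_right (d i) ℓ),
    Finset.prod_const, Finset.card_univ, Fintype.card_fin]

/-- REM 7.13's number: on a principally polarized abelian variety of dimension `g` (type `(1, …, 1)`) the simple
semi-homogeneous bundle of slope `Ξ/2` has rank `2^g`. [cite: Mukai1978, Rem 7.13 (p. 272)] -/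
theorem pow_div_prod_gcd_principal_half (g : ℕ) :
    2 ^ g / ∏ _i : Fin g, Nat.gcd 1 2 = 2 ^ g := by
  simp

end Literature.AlgebraicGeometry.AbelianVarieties
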